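/-
RSCONJ row B (PLANNER-A RSCONJ TABLE HOME∕INBOX l.14934; ident-2 R.1-B, IDENT-2-SPEC-RSCONJ.md; pen prover-pub-hodgecm2-mukey-p9-g0-0):
the CONJUGATE hermitian 3-space `V.conj` at the same pin and the transport of the model's bookkeeping objects along `c ⊗ 1`, on top of
mukey-p6's row FRAME ✔ `HComp/RecordSystemConjFrame.lean`.  HC_CM is NOT proved; HELD — WORLD = C FINAL.
-/
import Summits.HodgeConjecture.CorCM.B01.Transposition.HComp.Levels
import Summits.HodgeConjecture.CorCM.B01.Transposition.HComp.RecordCarriers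
import Literature.NumberTheory.Automorphic.AutomorphicGaloisConj
import Summits.HodgeConjecture.CorCM.B01.Transposition.HComp.RecordSystemConjFrame
import HarnessLib

set_option autoImplicit false

noncomputable section

/-!
# RSCONJ row B (PLANNER-A RSCONJ TABLE, HOME/INBOX l.14934; ident-2 R.1-B, IDENT-2-SPEC-RSCONJ.md): the CONJUGATE hermitian 3-space
`V.conj` at the SAME pin `ι₁`, and the transport of the model's bookkeeping objects (`adelicFin`, the chosen frame `frameOf`, the
threshold `K3`) along `c ⊗ 1` — seat prover-pub-hodgecm2-mukey-p9-g0-0.  ONE `def` (`HermSpace3.conj`) + ONE `def` (`frameTwist`, an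
explicit matrix) + theorems; no instance, no `variable`-fact, no notation, no `sorry`.  HC_CM is NOT proved; HELD — WORLD = C FINAL.

* `HermSpace3.conj V` : Gram `conjGram F V.Hm` (`= V.Hmᵀ`, `conj_Hm_eq_transpose`), hermitian, signature `(2,1)` at `ι₁` witnessed by
  `conjFrame (frameOf V)`, positive definite off the place of `ι₁`; `conj_conj : V.conj.conj = V`.
* `adelicFin`: `V.conj.adelicFin = U(c H)(𝔸_{F⁺,f})` by `rfl`, so `groupConj F V.Hm : V.adelicFin ≃ₜ* V.conj.adelicFin` (`adelicFinConj`).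
* frames: `frameOf V.conj` is a CHOSEN Sylvester frame of `c(H)`; it differs from `conjFrame (frameOf V)` by the EXPLICIT unitary
  `frameTwist V := (conjFrame (frameOf V))⁻¹ * frameOf V.conj ∈ U(diag(1,1,-1))` (`frameOf_conj`, `conjTranspose_frameTwist_mul_mul`) — «related by
  an explicit unitary», not equal.
* levels: `conjLevel₀ F V.Hm (K3 V) = K3 V.conj` (`conjLevel₀_K3`): the principal congruence level `K_f(3)` is Galois-stable
  (`(c ⊗ 1)`-image of `K_f(3) ∩ U(H)` is `K_f(3) ∩ U(cH)`; tree ✔ `GLn.smul_mem_principalCongruenceLevel_iff_of_smul_eq` + `ofFinite_map_conjFiniteAdele`).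
-/

open scoped Matrix MatrixGroups Pointwise ComplexOrder

namespace Summit.HodgeConjecture.CorCM

open NumberField IsDedekindDomain
open Literature.NumberTheory.Automorphic Literature.NumberTheory.Automorphic.UnitaryGroup
open Literature.NumberTheory.Automorphic.Liu2021.AppendixC
open Literature.AlgebraicGeometry.ShimuraVarieties Literature.AlgebraicGeometry.ShimuraVarieties.UnitaryCanonicalModel
open Summit.HodgeConjecture.CorCM.D2Bridge.UnitaryGroupConj
open Summit.HodgeConjecture.CorCM.Model.RecordSystemConj (conjFrame conjGram groupConj conjLevel₀ formCongr_conjFrame coe_conjFrame)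

namespace HermSpace3

variable {F : CMField} {ι₁ : F →+* ℂ}

/-- Two hermitian 3-spaces at the same pin with the same Gram matrix are equal (the other fields are propositions). [folklore] -/
theorem ext_Hm {V W : HermSpace3 F ι₁} (h : V.Hm = W.Hm) : V = W := by
  cases V; cases W; cases h; rfl

/-- `c(H) = Hᵀ` for the Gram matrix of a hermitian 3-space (`isHermitian`: `c(H i j) = H j i`). [folklore] -/
theorem conjGram_Hm_eq_transpose (V : HermSpace3 F ι₁) : conjGram F V.Hm = V.Hmᵀ :=
  map_galConj_eq_transpose_of_hermitian (↥(maximalRealSubfield F)) F (IsCMField.complexConj F) 3 (fun i j => V.isHermitian i j)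

/-- `conjFrame (frameOf V)` is a Sylvester frame of signature `(2,1)` for `c(H)` at the SAME embedding `ι₁`:
`T̄ᴴ · (cH)^{ι₁} · T̄ = conj (Tᴴ H^{ι₁} T) = diag(1,1,-1)`. [folklore] -/
theorem conjTranspose_conjFrame_frameOf_mul_mul (V : HermSpace3 F ι₁) :
    (conjFrame (Model.frameOf V) : Matrix (Fin 3) (Fin 3) ℂ)ᴴ * (conjGram F V.Hm).map ι₁ * (conjFrame (Model.frameOf V) : Matrix (Fin 3) (Fin 3) ℂ) =
      signatureMatrix 2 := by
  have hHc : (conjGram F V.Hm).map ι₁ = (V.Hm.map ι₁).map (starRingEnd ℂ) := by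
    ext i j
    simp only [Matrix.map_apply, RingHom.coe_coe, NumberField.IsCMField.complexEmbedding_complexConj]
  have hS : (signatureMatrix 2 : Matrix (Fin 3) (Fin 3) ℂ).map (starRingEnd ℂ) = signatureMatrix 2 := by
    ext i j
    fin_cases i <;> fin_cases j <;> simp [signatureMatrix]
  have key := congrArg (fun M : Matrix (Fin 3) (Fin 3) ℂ => M.map (starRingEnd ℂ)) (Model.conjTranspose_frameOf_mul_mul V)
  simp only [Matrix.map_mul] at key
  rw [hS] at key
  rw [coe_conjFrame, hHc, ← Matrix.conjTranspose_map (starRingEnd ℂ) (fun _ => rfl)]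
  · exact key

/-- **The CONJUGATE hermitian 3-space `c(V)` at the same pin `ι₁`**: Gram matrix `c(H)` (`= Hᵀ`), hermitian, of signature `(2,1)` at
`ι₁` (frame `conjFrame (frameOf V)`) and positive definite at every embedding off the place of `ι₁` (transpose of a positive
definite matrix).  RSCONJ row B. [folklore] -/
noncomputable def conj (V : HermSpace3 F ι₁) : HermSpace3 F ι₁ where
  Hm := conjGram F V.Hm
  isHermitian i j := by
    show cmConjRingHom F ((IsCMField.complexConj F) (V.Hm i j)) = (IsCMField.complexConj F) (V.Hm j i)
    have h1 : cmConjRingHom F ((IsCMField.complexConj F) (V.Hm i j)) = V.Hm i j :=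
      IsCMField.complexConj_apply_apply F (V.Hm i j)
    rw [h1]
    exact (V.isHermitian j i).symm
  signature_ι₁ := ⟨conjFrame (Model.frameOf V), conjTranspose_conjFrame_frameOf_mul_mul V⟩
  posDef_of_ne τ hτ := by
    rw [conjGram_Hm_eq_transpose, Matrix.transpose_map]
    exact (V.posDef_of_ne τ hτ).transpose

/-- (definitional) the Gram matrix of `V.conj` is `c(H)`. [folklore] -/
@[simp] theorem conj_Hm (V : HermSpace3 F ι₁) : V.conj.Hm = conjGram F V.Hm := rfl

/-- the Gram matrix of `V.conj` is `Hᵀ`. [folklore] -/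
theorem conj_Hm_eq_transpose (V : HermSpace3 F ι₁) : V.conj.Hm = V.Hmᵀ := conjGram_Hm_eq_transpose V

/-- `c(c(V)) = V`. [folklore] -/
theorem conj_conj (V : HermSpace3 F ι₁) : V.conj.conj = V :=
  ext_Hm (by
    rw [conj_Hm, conj_Hm]
    ext i j
    simp only [Matrix.map_apply, RingHom.coe_coe]
    exact IsCMField.complexConj_apply_apply F (V.Hm i j))

/-- (definitional) the finite-adelic unitary group of `V.conj` is `U(cH)(𝔸_{F⁺,f})` — the codomain of `groupConj F V.Hm`. [folklore] -/
theorem conj_adelicFin (V : HermSpace3 F ι₁) :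
    V.conj.adelicFin = finAdelic (↥(maximalRealSubfield F)) F (IsCMField.complexConj F) 3 (conjGram F V.Hm) := rfl

/-- **`c ⊗ 1 : U(V)(𝔸_{F⁺,f}) ≃ₜ* U(c V)(𝔸_{F⁺,f})`**, typed at the two hermitian 3-spaces (= `groupConj F V.Hm`, wb-10's `finAdelicConj`).
[cite: PlatonovRapinchuk1994, §5.1] -/
noncomputable abbrev adelicFinConj (V : HermSpace3 F ι₁) : V.adelicFin ≃ₜ* V.conj.adelicFin := groupConj F V.Hm

/-- Underlying matrix of `adelicFinConj V g`: `GL₃(c ⊗ 1) g`. [folklore] -/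
theorem coe_adelicFinConj_apply (V : HermSpace3 F ι₁) (g : V.adelicFin) :
    ((V.adelicFinConj g : V.conj.adelicFin) : GL (Fin 3) (FiniteAdeleRing (𝓞 F) F)) =
      Matrix.GeneralLinearGroup.map (conjFiniteAdele (↥(maximalRealSubfield F)) F (IsCMField.complexConj F))
        (g : GL (Fin 3) (FiniteAdeleRing (𝓞 F) F)) := rfl

end HermSpace3

namespace Model.RecordSystemConj

variable {F : CMField} {ι₁ : F →+* ℂ}

/-! ### frames: `frameOf V.conj` vs `conjFrame (frameOf V)` — related by an explicit unitary -/

/-- **The frame twist** `u_V := T̄⁻¹ · T′` between the conjugate of the chosen frame of `V` (`T̄ = conjFrame (frameOf V)`) and the chosen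
frame of `V.conj` (`T′ = frameOf V.conj`); both are Sylvester frames of `c(H)` at `ι₁`, so `u_V ∈ U(diag(1,1,-1))`
(`conjTranspose_frameTwist_mul_mul`).  `frameOf V.conj` is a `Classical.choice` and need not equal `conjFrame (frameOf V)`. [folklore] -/
noncomputable def frameTwist (V : HermSpace3 F ι₁) : GL (Fin 3) ℂ := (conjFrame (Model.frameOf V))⁻¹ * Model.frameOf V.conj

/-- `frameOf V.conj = conjFrame (frameOf V) · u_V`. [folklore] -/
theorem frameOf_conj (V : HermSpace3 F ι₁) : Model.frameOf V.conj = conjFrame (Model.frameOf V) * frameTwist V := by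
  rw [frameTwist, mul_inv_cancel_left]

/-- **`u_V` is unitary for `diag(1,1,-1)`**: `u_Vᴴ · diag(1,1,-1) · u_V = diag(1,1,-1)`. [folklore] -/
theorem conjTranspose_frameTwist_mul_mul (V : HermSpace3 F ι₁) :
    (frameTwist V : Matrix (Fin 3) (Fin 3) ℂ)ᴴ * signatureMatrix 2 * (frameTwist V : Matrix (Fin 3) (Fin 3) ℂ) = signatureMatrix 2 := by
  have h1 := HermSpace3.conjTranspose_conjFrame_frameOf_mul_mul V           -- T̄ᴴ M T̄ = S
  have h2 : (Model.frameOf V.conj : Matrix (Fin 3) (Fin 3) ℂ)ᴴ * (conjGram F V.Hm).map ι₁ * (Model.frameOf V.conj : Matrix (Fin 3) (Fin 3) ℂ) =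
      signatureMatrix 2 := Model.conjTranspose_frameOf_mul_mul V.conj       -- T′ᴴ M T′ = S  (V.conj.Hm = conjGram F V.Hm, rfl)
  have hTi : (conjFrame (Model.frameOf V) : Matrix (Fin 3) (Fin 3) ℂ) * (((conjFrame (Model.frameOf V))⁻¹ : GL (Fin 3) ℂ) : Matrix (Fin 3) (Fin 3) ℂ) = 1 := by
    rw [← Units.val_mul, mul_inv_cancel, Units.val_one]
  have hTiH : (((conjFrame (Model.frameOf V))⁻¹ : GL (Fin 3) ℂ) : Matrix (Fin 3) (Fin 3) ℂ)ᴴ * (conjFrame (Model.frameOf V) : Matrix (Fin 3) (Fin 3) ℂ)ᴴ = 1 := by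
    rw [← Matrix.conjTranspose_mul, hTi, Matrix.conjTranspose_one]
  -- pure algebra: uᴴ (T̄ᴴ M T̄) u = T′ᴴ M T′ for u = T̄⁻¹ T′
  have key : (frameTwist V : Matrix (Fin 3) (Fin 3) ℂ)ᴴ *
      ((conjFrame (Model.frameOf V) : Matrix (Fin 3) (Fin 3) ℂ)ᴴ * (conjGram F V.Hm).map ι₁ * (conjFrame (Model.frameOf V) : Matrix (Fin 3) (Fin 3) ℂ)) *
      (frameTwist V : Matrix (Fin 3) (Fin 3) ℂ) =
      (Model.frameOf V.conj : Matrix (Fin 3) (Fin 3) ℂ)ᴴ * (conjGram F V.Hm).map ι₁ * (Model.frameOf V.conj : Matrix (Fin 3) (Fin 3) ℂ) := by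
    rw [frameTwist, Units.val_mul, Matrix.conjTranspose_mul]
    simp only [Matrix.mul_assoc]
    rw [← Matrix.mul_assoc (conjFrame (Model.frameOf V) : Matrix (Fin 3) (Fin 3) ℂ)
      (((conjFrame (Model.frameOf V))⁻¹ : GL (Fin 3) ℂ) : Matrix (Fin 3) (Fin 3) ℂ), hTi, Matrix.one_mul,
      ← Matrix.mul_assoc (((conjFrame (Model.frameOf V))⁻¹ : GL (Fin 3) ℂ) : Matrix (Fin 3) (Fin 3) ℂ)ᴴ, hTiH, Matrix.one_mul]
  calc (frameTwist V : Matrix (Fin 3) (Fin 3) ℂ)ᴴ * signatureMatrix 2 * (frameTwist V : Matrix (Fin 3) (Fin 3) ℂ)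
      = (frameTwist V : Matrix (Fin 3) (Fin 3) ℂ)ᴴ *
          ((conjFrame (Model.frameOf V) : Matrix (Fin 3) (Fin 3) ℂ)ᴴ * (conjGram F V.Hm).map ι₁ * (conjFrame (Model.frameOf V) : Matrix (Fin 3) (Fin 3) ℂ)) *
          (frameTwist V : Matrix (Fin 3) (Fin 3) ℂ) := by rw [h1]
    _ = (Model.frameOf V.conj : Matrix (Fin 3) (Fin 3) ℂ)ᴴ * (conjGram F V.Hm).map ι₁ * (Model.frameOf V.conj : Matrix (Fin 3) (Fin 3) ℂ) := key
    _ = signatureMatrix 2 := h2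

/-! ### levels: `K_f(3)` is Galois-stable, so `c(K3 V) = K3 (c V)` -/

/-- `(1, (c ⊗ 1) h) = c • (1, h)` in `GL₃(𝔸_F)`: the finite-part embedding `GLn.ofFinite` intertwines wb-10's `GL₃(c ⊗ 1)` with the tree's
entrywise Galois action on `GL₃(𝔸_F)` (`AutomorphicGaloisConj`). [folklore] -/
theorem ofFinite_map_conjFiniteAdele (σ : F ≃ₐ[↥(maximalRealSubfield F)] F) (h : GL (Fin 3) (FiniteAdeleRing (𝓞 F) F)) :
    GLn.ofFinite 3 F (Matrix.GeneralLinearGroup.map (conjFiniteAdele (↥(maximalRealSubfield F)) F σ) h) = σ • GLn.ofFinite 3 F h := by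
  refine Matrix.GeneralLinearGroup.ext fun i j => ?_
  rw [GeneralLinearGroup.coe_smul_apply, GLn.coe_ofFinite_apply, GLn.coe_ofFinite_apply]
  refine Prod.ext ?_ ?_
  · rw [AdeleRing.smul_fst, Matrix.one_apply]
    split_ifs
    · exact (smul_one σ).symm
    · exact (smul_zero σ).symm
  · rw [AdeleRing.smul_snd]
    rfl

/-- The level ideal `(3) ⊆ 𝓞_F` is Galois-stable (it is extended from `𝓞_{F⁺}`). [folklore] -/
theorem smul_span_three (σ : F ≃ₐ[↥(maximalRealSubfield F)] F) :
    σ • Ideal.span {((3 : ℕ) : 𝓞 F)} = Ideal.span {((3 : ℕ) : 𝓞 F)} := by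
  have h3 : Ideal.span {((3 : ℕ) : 𝓞 F)} = (Ideal.span {((3 : ℕ) : 𝓞 ↥(maximalRealSubfield F))}).map
      (algebraMap (𝓞 ↥(maximalRealSubfield F)) (𝓞 F)) := by
    rw [Ideal.map_span, Set.image_singleton, map_natCast]
  rw [h3]
  exact Ideal.smul_map_algebraMap (↥(maximalRealSubfield F)) σ _

/-- **`(c ⊗ 1) g ∈ K_f(3) ∩ U(cH) ↔ g ∈ K_f(3) ∩ U(H)`** (the threshold is Galois-stable). [folklore] -/
theorem adelicFinConj_mem_K3_iff (V : HermSpace3 F ι₁) (g : V.adelicFin) :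
    V.adelicFinConj g ∈ ((HComp.K3 V.conj).1 : Subgroup V.conj.adelicFin) ↔ g ∈ ((HComp.K3 V).1 : Subgroup V.adelicFin) := by
  rw [HComp.K3_coe_eq_finCongruenceLevel, HComp.K3_coe_eq_finCongruenceLevel, mem_finCongruenceLevel_iff, mem_finCongruenceLevel_iff,
    HermSpace3.coe_adelicFinConj_apply, ofFinite_map_conjFiniteAdele,
    GLn.smul_mem_principalCongruenceLevel_iff_of_smul_eq (↥(maximalRealSubfield F)) (IsCMField.complexConj F) (smul_span_three (IsCMField.complexConj F))]

/-- **`c(K3 V) = K3 (c V)`**: the transported threshold `conjLevel₀ F V.Hm (K3 V)` (image of `K_f(3) ∩ U(H)` under `c ⊗ 1`) IS the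
threshold `K3 V.conj = K_f(3) ∩ U(cH)` of the conjugate space — so the small levels of the two records are re-indexed by
`smallLevelConjBack` EXACTLY onto each other. [folklore] -/
theorem conjLevel₀_K3 (V : HermSpace3 F ι₁) : conjLevel₀ F V.Hm (HComp.K3 V) = HComp.K3 V.conj := by
  apply Subtype.ext
  ext d
  change d ∈ ((HComp.K3 V).1 : Subgroup V.adelicFin).map (groupConj F V.Hm).toMulEquiv.toMonoidHom ↔ _
  rw [Subgroup.mem_map]
  constructor
  · rintro ⟨g, hg, rfl⟩
    exact (adelicFinConj_mem_K3_iff V g).2 hg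
  · intro hd
    refine ⟨(groupConj F V.Hm).symm d, (adelicFinConj_mem_K3_iff V _).1 ?_, (groupConj F V.Hm).apply_symm_apply d⟩
    change (groupConj F V.Hm) ((groupConj F V.Hm).symm d) ∈ _
    rw [(groupConj F V.Hm).apply_symm_apply]
    exact hd

end Model.RecordSystemConj

end Summit.HodgeConjecture.CorCM

end
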